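import Summits.Ventures.RobinTFree.RobinTFree24
import Literature.NumberTheory.LFunctions.RobinBriggsRange
import Literature.NumberTheory.LFunctions.RobinAnalytic
import HarnessLib

/-!
# Robin's inequality for every 12-free integer, from the tree's kernel range and the printed θ-bounds only

Cell topic `Summits/Ventures/RobinTFree` (rh-explicit ROBIN calibration track). Pure proof file; the
**in-tree rung** of the `t`-free ladder (referee map REFEREE-ROBIN §3 M4): the computational hypothesis
(H1) `MorrillPlatt2021_cor2` of `robinInequality_of_tFree_24` (Robin's inequality verified to
`29 996 208 012 611#`, carried AS PRINTED) is replaced by the tree's own kernel-certified range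
`robinInequality_le_ten_pow_1958000` (`RobinBriggsRange.lean`: Robin's inequality for
`5041 ≤ n ≤ 10^1958000`, unconditional). What remains assumed are the two refereed analytic theorems
(H2) `Buthe2018_thm2_theta` (Büthe 2018, Thm 2: `0.05√x < x − θ(x) ≤ 1.95√x` on `[1423, 10¹⁹]`) and
(H3) `BroadbentEtAl2021_theta_rel_1e19` (BKLNW 2021, §1.2: `|θ(x) − x| < 3.79·10⁻⁵ x/log²x`,
`x ≥ 10¹⁹`; any constant `≤ 4·10⁻⁵` works). **Main theorem** `robinInequality_of_tFree_12`:

  `Buthe2018_thm2_theta → BroadbentEtAl2021_theta_rel_1e19 → ∀ n > 5040, TFree 12 n → σ(n) < e^γ n log log n`.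

The price of dropping (H1) is the height at which the analytic leg must start: `x₀ = 4 508 461` (prime;
`θ(x₀) < x₀ ≤ 1958000 · log 10`, so `x₀# ≤ 10^1958000`) instead of `p₀ = 3.0·10¹³`; there
`E(x) ≤ E1(x₀) ≤ 1.27·10⁻⁴` and `−log(1 − 1.95/√x₀)/log x₀ = 6.0·10⁻⁵`, against the budget
`2⁻¹² = 2.44·10⁻⁴` (margin 24 %; `t = 13` fails: `2⁻¹³ < E1(x₀)`). In print the unconditional-range
rungs are `t = 7` (Solé–Planat 2012) and `t = 11` (Broughan–Trudgian 2015), both on Briggs's floating-point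
range `10^(10^10)`; this statement is a derived calibration (kernel range + printed θ-bounds), not a record
(the refereed theorem of record is Axler 2023, Thm 1.2, `t = 21`).

## References
* K. Briggs, Experiment. Math. 15 (2006) 251–256 (the range method). [Briggs2006]
* P. Solé, M. Planat, Integers 12 (2012) A65. [SolePlanat2012]
* K. Broughan, T. Trudgian, Integers 15 (2015) A12. [BroughanTrudgian2015]
* J. Büthe, Math. Comp. 87 (2018), Thm 2. [Buthe2018]
* S. Broadbent, H. Kadiri, A. Lumley, N. Ng, K. Wilk, Math. Comp. 90 (2021), §1.2. [BKLNW2021]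
-/

noncomputable section

open Real Finset
open scoped Chebyshev

namespace Summit.Ventures.RobinTFree

open Literature.NumberTheory.LFunctions Literature.NumberTheory.LFunctions.RobinTFree

/-! ### The starting prime `x₀ = 4 508 461` and its numerical lower bounds -/

/-- `x₀ = 4 508 461 = ⌊1958000 · 2.3025850925⌋` is prime. [folklore] -/
theorem prime_x0 : Nat.Prime 4508461 := by norm_num

/-- `log q ≥ 15.249` for `q ≥ x₀` (`x₀ ≥ 2²²`, `log 2 > 0.6931471803`). [folklore] -/
theorem log_x0_ge {q : ℝ} (hq : (4508461 : ℝ) ≤ q) : (15.249 : ℝ) ≤ Real.log q := by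
  have h2 : (2:ℝ) ^ 22 ≤ q := le_trans (by norm_num) hq
  have := Real.log_le_log (by positivity) h2
  rw [Real.log_pow] at this
  have hl2 := Real.log_two_gt_d9
  push_cast at this
  linarith

/-- `√q ≥ 2123` for `q ≥ x₀` (`2123² = 4 507 129`). [folklore] -/
theorem sqrt_x0_ge {q : ℝ} (hq : (4508461 : ℝ) ≤ q) : (2123 : ℝ) ≤ √q :=
  Real.le_sqrt_of_sq_le (le_trans (by norm_num) hq)

/-! ### The range leg: `x₀# ≤ 10^1958000`, so the tree's certified range covers `n < x₀#` -/

/-- Under Büthe's bound (`θ(x) < x` below `10¹⁹`), `x₀# < 10^1958000`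
(`log x₀# = θ(x₀) < x₀ = 4 508 461 ≤ 1958000 · 2.3025850925 < 1958000 · log 10`). [folklore] -/
theorem primorial_x0_lt (hB : Buthe2018_thm2_theta) : primorial 4508461 < 10 ^ 1958000 := by
  have hθ : θ (4508461 : ℝ) = Real.log (primorial 4508461 : ℕ) := by
    rw [Chebyshev.theta_eq_log_primorial, Nat.floor_ofNat]
  have hlt : θ (4508461 : ℝ) < 4508461 := hB.theta_lt (by norm_num) (by norm_num)
  have h10 : (4508461 : ℝ) < 1958000 * Real.log 10 := by
    have := RobinAnalytic.log_ten_gt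
    linarith
  have hkey : Real.log (primorial 4508461 : ℕ) < Real.log ((10 : ℝ) ^ (1958000 : ℕ)) := by
    rw [Real.log_pow, ← hθ]
    push_cast
    linarith
  have hpos : (0 : ℝ) < (primorial 4508461 : ℕ) := by exact_mod_cast primorial_pos _
  have hreal : ((primorial 4508461 : ℕ) : ℝ) < (10 : ℝ) ^ (1958000 : ℕ) :=
    (Real.log_lt_log_iff hpos (pow_pos (by norm_num) _)).1 hkey
  have hcast : ((primorial 4508461 : ℕ) : ℝ) < ((10 ^ 1958000 : ℕ) : ℝ) := by
    rw [Nat.cast_pow, Nat.cast_ofNat]; exact hreal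
  exact Nat.cast_lt.1 hcast

/-- The range leg from the tree: Robin's inequality for `5040 < n < x₀#` (kernel-certified range
`robinInequality_le_ten_pow_1958000`, given `x₀# < 10^1958000`). [folklore] -/
theorem robinInequality_lt_primorial_x0 (hB : Buthe2018_thm2_theta) {n : ℕ} (hn : 5040 < n)
    (hlt : n < primorial 4508461) : robinInequality n :=
  robinInequality_le_ten_pow_1958000 n (Nat.succ_le_of_lt hn)
    (Nat.le_of_lt (lt_trans hlt (primorial_x0_lt hB)))

/-! ### The Dedekind product versus Mertens' product, general `t` -/

/-- `∏_{p≤q} dedekindFactor t p ≤ (1 − 2⁻ᵗ) · ∏_{p≤q} (1 − 1/p)⁻¹` for `q ≥ 2` (only the factor at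
`p = 2` of `∏(1 − p⁻ᵗ)` is kept). [folklore] -/
theorem prod_dedekindFactor_le_pow (t : ℕ) {q : ℕ} (hq : 2 ≤ q) :
    ∏ p ∈ Nat.primesLE q, dedekindFactor t p ≤
      (1 - (2 : ℝ)⁻¹ ^ t) * ∏ p ∈ Nat.primesLE q, (1 - (p : ℝ)⁻¹)⁻¹ := by
  have hprime : ∀ p ∈ Nat.primesLE q, p.Prime := fun p hp => (Nat.mem_primesLE.1 hp).2
  rw [Finset.prod_congr rfl fun p hp => dedekindFactor_eq (hprime p hp).two_le, Finset.prod_mul_distrib]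
  refine mul_le_mul_of_nonneg_right ?_ (Finset.prod_nonneg fun p hp => ?_)
  · have h2 : 2 ∈ Nat.primesLE q := Nat.mem_primesLE.2 ⟨hq, Nat.prime_two⟩
    rw [← Finset.mul_prod_erase _ _ h2]
    push_cast
    refine mul_le_of_le_one_right ?_ (Finset.prod_le_one (fun p hp => ?_) fun p hp => ?_)
    · have : ((2:ℝ)⁻¹) ^ t ≤ 1 := pow_le_one₀ (by norm_num) (by norm_num)
      linarith
    · have hp := (hprime p (Finset.mem_of_mem_erase hp)).pos
      have : ((p:ℝ)⁻¹) ^ t ≤ 1 := pow_le_one₀ (by positivity)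
        (inv_le_one_of_one_le₀ (by exact_mod_cast hp))
      linarith
    · have : 0 ≤ ((p:ℝ)⁻¹) ^ t := by positivity
      linarith
  · have hp2 : (2 : ℝ) ≤ p := by exact_mod_cast (hprime p hp).two_le
    have : (p : ℝ)⁻¹ ≤ 1 / 2 := by rw [inv_eq_one_div]; exact one_div_le_one_div_of_le (by norm_num) hp2
    have : 0 < 1 - (p : ℝ)⁻¹ := by linarith
    positivity

/-! ### The analytic leg at primorials `q#`, `q ≥ x₀` -/

/-- `E1(c, q) ≤ 1.27·10⁻⁴` for `x₀ ≤ q` and `0 ≤ c ≤ 4·10⁻⁵`. [folklore] -/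
theorem E1_le_x0 {c q : ℝ} (hc0 : 0 ≤ c) (hc : c ≤ 4e-5) (hq : (4508461 : ℝ) ≤ q) :
    E1 c q ≤ 1.27e-4 := by
  have hL := log_x0_ge hq
  have hs := sqrt_x0_ge hq
  have hLX := log_ten_pow_19_ge (le_refl ((10:ℝ) ^ 19))
  have hL0 : (0:ℝ) < Real.log q := by linarith
  have hs0 : (0:ℝ) < √q := by linarith
  set L := Real.log q with hLdef
  set s := √q with hsdef
  set M := Real.log ((10:ℝ) ^ 19) with hMdef
  have hM0 : (0:ℝ) < M := by linarith
  have e1 : -0.05 / (s * L) + 3.9 * (1 + L) / (s * L ^ 2) = (3.9 / L ^ 2 + 3.85 / L) / s := by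
    field_simp; ring
  have b3 : (3.9 / L ^ 2 + 3.85 / L) / s ≤ (3.9 / 15.249 ^ 2 + 3.85 / 15.249) / 2123 := by
    calc (3.9 / L ^ 2 + 3.85 / L) / s ≤ (3.9 / L ^ 2 + 3.85 / L) / 2123 := by gcongr
      _ ≤ _ := by gcongr
  have b4 : bklnwTail c M ≤ 4e-5 * (1 / (2 * 39.5 ^ 2) + 1 / (3 * 39.5 ^ 3)) := by
    unfold bklnwTail
    calc c * (1 / (2 * M ^ 2) + 1 / (3 * M ^ 3)) ≤ c * (1 / (2 * 39.5 ^ 2) + 1 / (3 * 39.5 ^ 3)) := by gcongr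
      _ ≤ 4e-5 * (1 / (2 * 39.5 ^ 2) + 1 / (3 * 39.5 ^ 3)) := by gcongr
  unfold E1
  rw [← hLdef, ← hsdef, ← hMdef, e1]
  have : (3.9 / 15.249 ^ 2 + 3.85 / 15.249) / 2123 +
      4e-5 * (1 / (2 * 39.5 ^ 2) + 1 / (3 * 39.5 ^ 3)) ≤ (1.27e-4 : ℝ) := by norm_num
  linarith

/-- **The analytic inequality at primorials, in-tree height**: under Büthe's and BKLNW's θ-bounds,
for every prime `q ≥ x₀ = 4 508 461`, `∏_{p≤q} (1 + 1/p + ⋯ + 1/p¹¹) < e^γ log θ(q)`, i.e.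
`e^{−γ} R₁₂(q#) < 1`. Certificate: `(1 − 2⁻¹²)(1 + 1.27·10⁻⁴ + (1.27·10⁻⁴)²) L < L − u/(1 − u)` with
`u = 1.95/2123` for `L ≥ 15.249`, and the `q > 10¹⁹` branch as in `primorial_bound_24`. [folklore] -/
theorem primorial_bound_12 (hB : Buthe2018_thm2_theta) {c : ℝ} (hc0 : 0 ≤ c) (hc : c ≤ 4e-5)
    (hK : ThetaRelBound c) {q : ℕ} (hq : q.Prime) (hq0 : 4508461 ≤ q) :
    ∏ p ∈ Nat.primesLE q, dedekindFactor 12 p <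
      Real.exp eulerMascheroniConstant * Real.log (θ (q : ℝ)) := by
  have hqR : (4508461 : ℝ) ≤ q := by exact_mod_cast hq0
  have hq2 : (2 : ℝ) ≤ q := le_trans (by norm_num) hqR
  have hq1423 : (1423 : ℝ) ≤ q := le_trans (by norm_num) hqR
  have hq1 : (1 : ℝ) < q := by linarith
  have hL := log_x0_ge hqR
  have hs := sqrt_x0_ge hqR
  have hL0 : 0 < Real.log (q:ℝ) := by linarith
  have hs0 : 0 < √(q:ℝ) := by linarith
  set L := Real.log (q : ℝ) with hLdef
  -- two elementary inequalities: `exp E ≤ 1 + E + E²` (`|E| ≤ 1`) and `log(1 − u) ≥ −u/(1 − u)` (`u < 1`)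
  have exp_le_quad : ∀ {E : ℝ}, |E| ≤ 1 → Real.exp E ≤ 1 + E + E ^ 2 := fun {E} hE => by
    have := Real.abs_exp_sub_one_sub_id_le hE
    have := (abs_le.1 this).2
    linarith
  have log_one_sub_ge : ∀ {u : ℝ}, u < 1 → -(u / (1 - u)) ≤ Real.log (1 - u) := fun {u} hu1 => by
    have hpos : 0 < 1 - u := by linarith
    have := Real.one_sub_inv_le_log_of_pos hpos
    have e : 1 - (1 - u)⁻¹ = -(u / (1 - u)) := by field_simp; ring
    linarith [e]
  -- Mertens with remainder
  have hint := integrableOn_theta_sub_mul_weight_Ioi hK hq1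
  have hM := prod_one_sub_inv_inv_le hq2 hint
  rw [Nat.floor_natCast] at hM
  have hD := prod_dedekindFactor_le_pow 12 (q := q) (by exact_mod_cast hq.two_le)
  have hγ : 0 < Real.exp eulerMascheroniConstant := Real.exp_pos _
  set P := ∏ p ∈ Nat.primesLE q, (1 - (p : ℝ)⁻¹)⁻¹ with hPdef
  set E := mertensRemainder (q : ℝ) with hEdef
  have c12 : (1 - (2 : ℝ)⁻¹ ^ 12) = 1 - 2.44140625e-4 := by norm_num
  have hP0 : 0 ≤ P := by
    refine Finset.prod_nonneg fun p hp => ?_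
    have hp2 : (2 : ℝ) ≤ p := by exact_mod_cast (Nat.mem_primesLE.1 hp).2.two_le
    have : (p : ℝ)⁻¹ ≤ 1 / 2 := by rw [inv_eq_one_div]; exact one_div_le_one_div_of_le (by norm_num) hp2
    have : 0 < 1 - (p : ℝ)⁻¹ := by linarith
    positivity
  by_cases hcase : (q : ℝ) ≤ (10:ℝ) ^ 19
  · -- Büthe regime `x₀ ≤ q ≤ 10¹⁹`
    have hE : E ≤ 1.27e-4 := (mertensRemainder_le_E1 hB hK hq1423 hcase).trans (E1_le_x0 hc0 hc hqR)
    have hexp : Real.exp E ≤ 1 + 1.27e-4 + 1.27e-4 ^ 2 := by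
      have hE' : |E| ≤ 1 ∨ E < -1 := by
        by_cases h : -1 ≤ E
        · exact Or.inl (abs_le.2 ⟨h, by linarith⟩)
        · exact Or.inr (by linarith)
      rcases hE' with h | h
      · calc Real.exp E ≤ 1 + E + E ^ 2 := exp_le_quad h
          _ ≤ 1 + 1.27e-4 + 1.27e-4 ^ 2 := by nlinarith [abs_le.1 h]
      · calc Real.exp E ≤ Real.exp 0 := Real.exp_le_exp.2 (by linarith)
          _ ≤ _ := by norm_num
    -- θ(q) ≥ q − 1.95 √q
    have hθ : (q : ℝ) - 1.95 * √(q:ℝ) ≤ θ (q : ℝ) := by linarith [hB.1 (q:ℝ) hq1423 hcase]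
    have hu : 1.95 / √(q:ℝ) ≤ 1.95 / 2123 := by gcongr
    have hu1 : 1.95 / √(q:ℝ) < 1 := lt_of_le_of_lt hu (by norm_num)
    have hu0 : 0 ≤ 1.95 / √(q:ℝ) := by positivity
    have e : (q : ℝ) - 1.95 * √(q:ℝ) = (q:ℝ) * (1 - 1.95 / √(q:ℝ)) := by
      have hsq : (q:ℝ) = √(q:ℝ) * √(q:ℝ) := (Real.mul_self_sqrt (by linarith)).symm
      have hdiv : (q:ℝ) / √(q:ℝ) = √(q:ℝ) := by rw [div_eq_iff hs0.ne']; exact hsq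
      calc (q : ℝ) - 1.95 * √(q:ℝ) = (q:ℝ) - 1.95 * ((q:ℝ) / √(q:ℝ)) := by rw [hdiv]
        _ = (q:ℝ) * (1 - 1.95 / √(q:ℝ)) := by ring
    have hθpos : 0 < (q : ℝ) - 1.95 * √(q:ℝ) := by
      rw [e]; exact mul_pos (by linarith) (by linarith)
    have hlogθ : L + Real.log (1 - 1.95 / √(q:ℝ)) ≤ Real.log (θ (q:ℝ)) := by
      calc L + Real.log (1 - 1.95 / √(q:ℝ)) = Real.log ((q:ℝ) * (1 - 1.95 / √(q:ℝ))) := by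
            rw [Real.log_mul (by linarith) (by linarith)]
        _ ≤ Real.log (θ (q:ℝ)) := Real.log_le_log (by rw [← e]; exact hθpos) (by rw [← e]; exact hθ)
    have hlog1 : -((1.95 / 2123) / (1 - 1.95 / 2123)) ≤ Real.log (1 - 1.95 / √(q:ℝ)) := by
      refine le_trans ?_ (log_one_sub_ge hu1)
      have : (1.95 / √(q:ℝ)) / (1 - 1.95 / √(q:ℝ)) ≤ (1.95 / 2123) / (1 - 1.95 / 2123) := by
        gcongr
      linarith
    -- assemble: LHS ≤ (1−2⁻¹²) e^γ L e^E < e^γ (L − u/(1−u)) ≤ e^γ log θ(q)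
    have key : (1 - 2.44140625e-4) * (L * (1 + 1.27e-4 + 1.27e-4 ^ 2)) <
        L - (1.95 / 2123) / (1 - 1.95 / 2123) := by
      have hc : (0:ℝ) < 1 - (1 - 2.44140625e-4) * (1 + 1.27e-4 + 1.27e-4 ^ 2) := by
        norm_num
      have h1 := mul_le_mul_of_nonneg_left hL hc.le
      have h2 : (1.95 / 2123) / (1 - 1.95 / 2123) <
          (1 - (1 - 2.44140625e-4) * (1 + 1.27e-4 + 1.27e-4 ^ 2)) * (15.249:ℝ) := by
        norm_num
      linarith
    calc ∏ p ∈ Nat.primesLE q, dedekindFactor 12 p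
        ≤ (1 - (2 : ℝ)⁻¹ ^ 12) * P := hD
      _ ≤ (1 - (2 : ℝ)⁻¹ ^ 12) * (Real.exp eulerMascheroniConstant * L * Real.exp E) :=
          mul_le_mul_of_nonneg_left hM (by norm_num)
      _ ≤ (1 - (2 : ℝ)⁻¹ ^ 12) * (Real.exp eulerMascheroniConstant * L * (1 + 1.27e-4 + 1.27e-4 ^ 2)) := by
          gcongr
      _ = Real.exp eulerMascheroniConstant * ((1 - 2.44140625e-4) * (L * (1 + 1.27e-4 + 1.27e-4 ^ 2))) := by
          rw [c12]; ring
      _ < Real.exp eulerMascheroniConstant * (L - (1.95 / 2123) / (1 - 1.95 / 2123)) :=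
          mul_lt_mul_of_pos_left key hγ
      _ ≤ Real.exp eulerMascheroniConstant * Real.log (θ (q:ℝ)) :=
          mul_le_mul_of_nonneg_left (by linarith) hγ.le
  · -- BKLNW regime, `q > 10¹⁹`
    push Not at hcase
    have hX : (10:ℝ) ^ 19 ≤ q := hcase.le
    have hLX := log_ten_pow_19_ge hX
    have hE : E ≤ 1.37e-8 := (mertensRemainder_le_E2 hK hX).trans (E2_le hc0 hc hX)
    have hexp : Real.exp E ≤ 1 + 1.37e-8 + 1.37e-8 ^ 2 := by
      have hE' : |E| ≤ 1 ∨ E < -1 := by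
        by_cases h : -1 ≤ E
        · exact Or.inl (abs_le.2 ⟨h, by linarith⟩)
        · exact Or.inr (by linarith)
      rcases hE' with h | h
      · calc Real.exp E ≤ 1 + E + E ^ 2 := exp_le_quad h
          _ ≤ 1 + 1.37e-8 + 1.37e-8 ^ 2 := by nlinarith [abs_le.1 h]
      · calc Real.exp E ≤ Real.exp 0 := Real.exp_le_exp.2 (by linarith)
          _ ≤ _ := by norm_num
    -- θ(q) ≥ q (1 − c/L²)
    have hq0' : (0:ℝ) < q := by linarith
    have hK' : |θ (q:ℝ) - q| < c / L ^ 2 * q := by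
      calc |θ (q:ℝ) - q| < c * q / Real.log q ^ 2 := hK q hX
        _ = c / L ^ 2 * q := by rw [hLdef]; ring
    have hv : c / L ^ 2 ≤ 4e-5 / 39.5 ^ 2 := by gcongr
    have hv1 : c / L ^ 2 < 1 := lt_of_le_of_lt hv (by norm_num)
    have hv0 : 0 ≤ c / L ^ 2 := by positivity
    have hθ : (q:ℝ) * (1 - c / L ^ 2) ≤ θ (q:ℝ) := by
      have h2 := (abs_lt.1 hK').1
      have h3 : (q:ℝ) * (1 - c / L ^ 2) = q - c / L ^ 2 * q := by ring
      rw [h3]; linarith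
    have hθpos : 0 < (q:ℝ) * (1 - c / L ^ 2) := mul_pos hq0' (by linarith)
    have hlogθ : L + Real.log (1 - c / L ^ 2) ≤ Real.log (θ (q:ℝ)) := by
      calc L + Real.log (1 - c / L ^ 2) = Real.log ((q:ℝ) * (1 - c / L ^ 2)) := by
            rw [Real.log_mul (by linarith) (by linarith)]
        _ ≤ Real.log (θ (q:ℝ)) := Real.log_le_log hθpos hθ
    have hlog1 : -((4e-5 / 39.5 ^ 2) / (1 - 4e-5 / 39.5 ^ 2)) ≤ Real.log (1 - c / L ^ 2) := by
      refine le_trans ?_ (log_one_sub_ge hv1)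
      have : (c / L ^ 2) / (1 - c / L ^ 2) ≤ (4e-5 / 39.5 ^ 2) / (1 - 4e-5 / 39.5 ^ 2) := by
        gcongr
      linarith
    have key : (1 - 2.44140625e-4) * (L * (1 + 1.37e-8 + 1.37e-8 ^ 2)) <
        L - (4e-5 / 39.5 ^ 2) / (1 - 4e-5 / 39.5 ^ 2) := by
      have hc : (0:ℝ) < 1 - (1 - 2.44140625e-4) * (1 + 1.37e-8 + 1.37e-8 ^ 2) := by
        norm_num
      have hLL : (39.5:ℝ) ≤ L := hLX
      have h1 := mul_le_mul_of_nonneg_left hLL hc.le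
      have h2 : (4e-5 / 39.5 ^ 2) / (1 - 4e-5 / 39.5 ^ 2) <
          (1 - (1 - 2.44140625e-4) * (1 + 1.37e-8 + 1.37e-8 ^ 2)) * (39.5:ℝ) := by
        norm_num
      linarith
    calc ∏ p ∈ Nat.primesLE q, dedekindFactor 12 p
        ≤ (1 - (2 : ℝ)⁻¹ ^ 12) * P := hD
      _ ≤ (1 - (2 : ℝ)⁻¹ ^ 12) * (Real.exp eulerMascheroniConstant * L * Real.exp E) :=
          mul_le_mul_of_nonneg_left hM (by norm_num)
      _ ≤ (1 - (2 : ℝ)⁻¹ ^ 12) * (Real.exp eulerMascheroniConstant * L * (1 + 1.37e-8 + 1.37e-8 ^ 2)) := by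
          gcongr
      _ = Real.exp eulerMascheroniConstant * ((1 - 2.44140625e-4) * (L * (1 + 1.37e-8 + 1.37e-8 ^ 2))) := by
          rw [c12]; ring
      _ < Real.exp eulerMascheroniConstant * (L - (4e-5 / 39.5 ^ 2) / (1 - 4e-5 / 39.5 ^ 2)) :=
          mul_lt_mul_of_pos_left key hγ
      _ ≤ Real.exp eulerMascheroniConstant * Real.log (θ (q:ℝ)) :=
          mul_le_mul_of_nonneg_left (by linarith) hγ.le

/-! ### Assembly -/

/-- Robin's inequality for every 12-free `n > 5040` from the tree's kernel range, Büthe's θ-bounds and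
ANY relative bound `|θ(x) − x| < c·x/log²x` (`x ≥ 10¹⁹`) with `0 ≤ c ≤ 4·10⁻⁵`. [folklore] -/
theorem robinInequality_of_tFree_12_of_thetaRelBound (hB : Buthe2018_thm2_theta) {c : ℝ}
    (hc0 : 0 ≤ c) (hc : c ≤ 4e-5) (hK : ThetaRelBound c) :
    ∀ n : ℕ, 5040 < n → TFree 12 n → robinInequality n :=
  robinInequality_of_tFree_of_primorial_bound (t := 12) (by norm_num) prime_x0
    (fun _ hq hq0 => primorial_bound_12 hB hc0 hc hK hq hq0)
    fun _ hn hlt => robinInequality_lt_primorial_x0 hB hn hlt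

/-- **Robin's inequality holds for every 12-free integer `n > 5040`**, on the tree's kernel-certified
range (`robinInequality_le_ten_pow_1958000`, unconditional), Büthe's Theorem 2 (`0.05√x < x − θ(x) ≤ 1.95√x`
on `[1423, 10¹⁹]`) and Broadbent–Kadiri–Lumley–Ng–Wilk's display `|θ(x) − x|/x < 3.79·10⁻⁵/log²x`
(`x ≥ 10¹⁹`) — i.e. with NO computational hypothesis: what the tree certifies by itself modulo two
refereed analytic theorems taken AS PRINTED. A derived calibration (rh-explicit ROBIN track, referee map
M4), not a record: in print `t = 11` holds on Briggs's range (Broughan–Trudgian 2015) and `t = 21` on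
Morrill–Platt's (Axler 2023, Thm 1.2); with (H1) `MorrillPlatt2021_cor2` added the same method gives
`t = 24` (`robinInequality_of_tFree_24`). -/
theorem robinInequality_of_tFree_12 (hB : Buthe2018_thm2_theta)
    (hK : BroadbentEtAl2021_theta_rel_1e19) :
    ∀ n : ℕ, 5040 < n → TFree 12 n → robinInequality n :=
  robinInequality_of_tFree_12_of_thetaRelBound hB (by norm_num) (by norm_num) (thetaRelBound_of_bklnw hK)

/-- **Robin's inequality on every `t`-free class with `t ≤ 12`**, same two hypotheses (covers the printed
unconditional-range rungs `t = 5, 7, 11`). [folklore] -/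
theorem robinInequality_of_tFree_le_12 (hB : Buthe2018_thm2_theta)
    (hK : BroadbentEtAl2021_theta_rel_1e19) {t : ℕ} (ht : t ≤ 12) :
    ∀ n : ℕ, 5040 < n → TFree t n → robinInequality n :=
  fun n hn htf => robinInequality_of_tFree_12 hB hK n hn (tFree_mono ht htf)

end Summit.Ventures.RobinTFree
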